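/-
Copyright (c) 2026. All rights reserved.
Released under Apache 2.0 license as described in the file LICENSE.
-/
import Literature.NumberTheory.ComplexMultiplication.DegenerateCMTypesElementaryAbelianPartiallyBentTypesQuotient
import HarnessLib

/-!
# The census of IMPRIMITIVE near-bent CM types on an elementary abelian `2`-group: the partially-bent types with a
# stabiliser of order `2`, counted involution by involution — `62 · 896 = 55 552` of them in order `64`

SETTING (tree `DegenerateCMTypesElementaryAbelianNearBentTypes`, `…NearBentTypesStabilizer`, `…PartiallyBentTypes`,
`…PartiallyBentTypesQuotient`).  `G` a finite commutative group of exponent `2`, `ρ ∈ G`, `T ⊆ G` a CM type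
(`|T| = m = |G|/2`), `Ŝ_T(χ) = Σ_{t∈T} χ(t)`, `c_g(T) = #{t ∈ T : tg ∈ T}`, `Stab(T) = {g : Tg = T}`.  `T` is NEAR-BENT
when `Ŝ_T(χ) ∈ {0, ±√(2m)}` for every odd `χ` (the semi-bent functions in an odd number of variables, C. Carlet
[Carlet2020] §6.2.4, §3.1 p. 81), PARTIALLY-BENT when `c_g(T) ∈ {0, m/2, m}` for all `g` ([Carlet2020] §6.2.1 Prop. 94 /
Def. 62); by the tree a near-bent type has `|Stab(T)| ∈ {1, 2}` (`card_stabilizer_eq_one_or_two`), with `|Stab(T)| = 2`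
iff it attains Shimura's reflex bound, iff (being plateaued) it is partially-bent, iff it is the concatenation `f ‖ f`
of a bent type of the quotient `G/Stab(T)` — the IMPRIMITIVE near-bent types, whose abelian varieties satisfy the Hodge
conjecture with all their powers (tree `MultiquadraticCMFieldNearBentTypes`); the PRIMITIVE ones (`|Stab(T)| = 1`)
carry exceptional Hodge classes.  THIS FILE counts the imprimitive ones, by the involution `a` generating the stabiliser:

> **Theorem** (`filter_nearBent_card_stabilizer_eq_two_eq`).  **Near-bent with `|Stab| = 2` ⟺ partially-bent with
> `|Stab| = 2`** (as finsets of types; any order).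
> **Theorem** (`card_filter_partiallyBent_card_stabilizer_eq_two_eq_sum`, THE PARTITION).  **`#{T partially-bent :
> |Stab(T)| = 2} = Σ_{a ∉ {1, ρ}} #{T partially-bent : Stab(T) = {1, a}}`**, and each summand is the number of bent CM
> types of the quotient `G/⟨a⟩` (tree `card_filter_partiallyBent_eq_card_filter_image`):
> `card_filter_stabilizer_eq_pair_eq_card_filter_image`.
> **Theorem** (`card_filter_nearBent_card_stabilizer_eq_two_of_card_eq_sixtyFour`, THE ORDER-`64` CENSUS).  **On the
> elementary abelian group of order `64` there are EXACTLY `62 · 896 = 55 552` near-bent CM types with a stabiliser of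
> order `2`** — `896` (`= |𝓑₄|`, the bent types of the order-`32` quotient) for each of the `62` involutions
> `a ∉ {1, ρ}`; hence (`card_filter_nearBent_eq_add_of_card_eq_sixtyFour`) the number of ALL near-bent types of order
> `64` is `55 552 + #{primitive near-bent types}` (the semi-bent functions of `5` variables without linear structure,
> not counted here).  Order `16`, for comparison: `14 · 8 = 112` (`card_filter_partiallyBent_card_stabilizer_eq_two_of_card_eq_sixteen`),
> which is the tree's total count of near-bent types of order `16` (all of them imprimitive).

HONEST SCOPE.  Counting corollaries of the tree's structure theorem and of the printed counts `|𝓑₂| = 8`, `|𝓑₄| = 896`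
(N. Tokareva [Tokareva2015BentFunctions] §7.1); the number `55 552` is this file's arithmetic (`62 · 896`), not a
printed figure, and the primitive near-bent types of order `64` are NOT counted (their existence is not decided here).
THEOREMS ONLY: no definition, no named fact, no instance, no `sorry`.

## References

* [Carlet2020] C. Carlet, *Boolean Functions for Cryptography and Coding Theory*, CUP (2020), §6.2.1 Proposition 94,
  Definition 62; §6.2.4 (semi-bent / near-bent); §3.1.4 Definition 25, Proposition 29 (linear structures).
* [Tokareva2015BentFunctions] N. Tokareva, *Bent Functions*, Academic Press (2015), §7.1 (`|𝓑₂| = 8`, `|𝓑₄| = 896`).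
* [Shimura1998] G. Shimura, *Abelian Varieties with Complex Multiplication and Modular Functions*, §8.2 Prop. 26, §32.10.
* [Kubota1965] T. Kubota, *On the field extension by complex multiplication*, Trans. AMS 118 (1965), §2, §4 Lemma 2.

## Provenance

Lane `lit-hodgefound` (Track 2, Layer A3), seat `lit-hodgefound-p10` generation 44, row g44-#4; neighbours cited by
name, nothing restated: `DegenerateCMTypesElementaryAbelianPartiallyBentTypesQuotient` (g44-#2:
`card_filter_partiallyBent_eq_card_filter_image`, `card_filter_partiallyBent_eq_of_card_eq_sixtyFour`,
`card_filter_partiallyBent_eq_of_card_eq_sixteen`, USED), `DegenerateCMTypesElementaryAbelianPartiallyBentTypes`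
(`sum_char_eq_zero_or_sq_eq`, `forall_card_filter_of_two_mul_card_stabilizer_mul_eq`, USED),
`DegenerateCMTypesElementaryAbelianNearBentTypesStabilizer` (`two_mul_card_stabilizer_mul_eq_iff_card_eq_two`,
`card_stabilizer_eq_one_or_two`, `card_stabilizer_eq_two_of_card_eq_sixteen`, USED),
`DegenerateCMTypesAbelianStabilizerIndexBound` (`one_mem_stabilizer`, `rho_not_forall_mul_mem_iff`, USED), Mathlib
`Subgroup.mem_zpowers_iff`, `Nat.card_zpowers`, `orderOf_eq_prime`, `Finset.card_biUnion`.
-/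

open scoped BigOperators Classical

namespace Literature.NumberTheory.ComplexMultiplication

namespace CyclicCMType

namespace ExponentTwo

namespace NearBentTypesCensus

open AbelianStabilizer (one_mem_stabilizer rho_not_forall_mul_mem_iff)
open PartiallyBentTypes (sum_char_eq_zero_or_sq_eq forall_card_filter_of_two_mul_card_stabilizer_mul_eq)
open NearBentTypesStabilizer (two_mul_card_stabilizer_mul_eq_iff_card_eq_two card_stabilizer_eq_one_or_two
  card_stabilizer_eq_two_of_card_eq_sixteen)
open PartiallyBentTypesQuotient (card_filter_partiallyBent_eq_card_filter_image
  card_filter_partiallyBent_eq_of_card_eq_sixtyFour card_filter_partiallyBent_eq_of_card_eq_sixteen)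

variable {G : Type*} [CommGroup G] [Fintype G] [DecidableEq G] {ρ : G} {T : Finset G}

/-! ## §0 Helpers: the subgroup `⟨a⟩ = {1, a}` of an involution -/

section Helpers

omit [Fintype G] [DecidableEq G] in
/-- `g·g = 1` in exponent `2`. [folklore] -/
private theorem mul_self_nc (hexp : ∀ g : G, g ^ 2 = 1) (g : G) : g * g = 1 := by
  rw [← pow_two]; exact hexp g

omit [Fintype G] [DecidableEq G] in
/-- In exponent `2`: `⟨a⟩ = {1, a}`. [folklore] -/
private theorem mem_zpowers_iff_nc (hexp : ∀ g : G, g ^ 2 = 1) (a g : G) :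
    g ∈ Subgroup.zpowers a ↔ g = 1 ∨ g = a := by
  constructor
  · intro hg
    obtain ⟨k, rfl⟩ := Subgroup.mem_zpowers_iff.1 hg
    have h2 : a ^ (2 : ℤ) = 1 := by rw [zpow_two]; exact mul_self_nc hexp a
    rw [zpow_eq_zpow_emod k h2]
    rcases Int.emod_two_eq_zero_or_one k with h0 | h1
    · left; rw [h0, zpow_zero]
    · right; rw [h1, zpow_one]
  · rintro (h1 | h1) <;> rw [h1]
    · exact (Subgroup.zpowers a).one_mem
    · exact Subgroup.mem_zpowers a

omit [Fintype G] [DecidableEq G] in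
/-- `|⟨a⟩| = 2` for an involution `a ≠ 1`. [folklore] -/
private theorem natCard_zpowers_nc (hexp : ∀ g : G, g ^ 2 = 1) {a : G} (ha1 : a ≠ 1) :
    Nat.card (Subgroup.zpowers a) = 2 := by
  rw [Nat.card_zpowers]
  exact orderOf_eq_prime (hexp a) ha1

/-- **`Stab(T) = {1, a}` ⟺ `⟨a⟩` is the stabiliser** (`a ≠ 1`, exponent `2`). [folklore] -/
private theorem stabilizer_eq_pair_iff_nc (hexp : ∀ g : G, g ^ 2 = 1) (a : G) :
    (Finset.univ.filter fun g : G => ∀ t : G, t * g ∈ T ↔ t ∈ T) = {1, a} ↔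
      ∀ g : G, g ∈ Subgroup.zpowers a ↔ ∀ t : G, t * g ∈ T ↔ t ∈ T := by
  constructor
  · intro h g
    rw [mem_zpowers_iff_nc hexp, ← Finset.mem_insert.trans (or_congr Iff.rfl Finset.mem_singleton), ← h,
      Finset.mem_filter]
    simp only [Finset.mem_univ, true_and]
  · intro h
    ext g
    rw [Finset.mem_filter, Finset.mem_insert, Finset.mem_singleton, ← mem_zpowers_iff_nc hexp a g, h g]
    simp only [Finset.mem_univ, true_and]

/-- **A stabiliser of order `2` is `{1, a}` for a unique involution `a ∉ {1, ρ}`.** [cite: Shimura1998, §8.1 Proposition 25 (proof)] -/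
private theorem exists_stabilizer_eq_pair_nc (h : IsCMTypeWith ρ (T : Set G))
    (h2 : (Finset.univ.filter fun g : G => ∀ t : G, t * g ∈ T ↔ t ∈ T).card = 2) :
    ∃ a : G, a ≠ 1 ∧ a ≠ ρ ∧ (Finset.univ.filter fun g : G => ∀ t : G, t * g ∈ T ↔ t ∈ T) = {1, a} := by
  obtain ⟨x, y, hxy, hS⟩ := Finset.card_eq_two.1 h2
  have h1 : (1 : G) ∈ ({x, y} : Finset G) := by rw [← hS]; exact one_mem_stabilizer T
  have hρ : ρ ∉ ({x, y} : Finset G) := by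
    rw [← hS]; intro hmem
    exact rho_not_forall_mul_mem_iff h (Finset.mem_filter.1 hmem).2
  rw [Finset.mem_insert, Finset.mem_singleton] at h1 hρ
  push Not at hρ
  rcases h1 with h1x | h1y
  · refine ⟨y, fun hy => hxy (by rw [← h1x, hy]), fun hy => hρ.2 hy.symm, ?_⟩
    rw [hS, ← h1x]
  · refine ⟨x, fun hx => hxy (by rw [← h1y, hx]), fun hx => hρ.1 hx.symm, ?_⟩
    rw [hS, ← h1y, Finset.pair_comm]

omit [Fintype G] in
/-- `|{1, a}| = 2` for `a ≠ 1`. [folklore] -/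
private theorem card_pair_nc {a : G} (ha1 : a ≠ 1) : ({1, a} : Finset G).card = 2 :=
  Finset.card_pair ha1.symm

/-- `#{a : a ≠ 1, a ≠ ρ} = |G| − 2` (`ρ ≠ 1`). [folklore] -/
private theorem card_filter_ne_ne_nc (hρ1 : ρ ≠ 1) :
    (Finset.univ.filter fun a : G => a ≠ 1 ∧ a ≠ ρ).card = Fintype.card G - 2 := by
  have hset : (Finset.univ.filter fun a : G => a ≠ 1 ∧ a ≠ ρ) = Finset.univ \ {1, ρ} := by
    ext a
    simp only [Finset.mem_filter, Finset.mem_univ, true_and, Finset.mem_sdiff, Finset.mem_insert,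
      Finset.mem_singleton, not_or]
  rw [hset, Finset.card_sdiff_of_subset (Finset.subset_univ _), Finset.card_univ, Finset.card_pair hρ1.symm]

end Helpers

/-! ## §1 Near-bent with `|Stab| = 2` ⟺ partially-bent with `|Stab| = 2` -/

section Dictionary

/-- **A partially-bent type with `|Stab(T)| = 2` is near-bent**: it is plateaued of squared amplitude
`|Stab(T)|·m = 2m` (tree `sum_char_eq_zero_or_sq_eq`). [cite: Carlet2020, §6.2.1 Definition 62] [cite: Carlet2020, §6.2.4] -/
theorem nearBent_of_partiallyBent_of_card_stabilizer_eq_two (hexp : ∀ g : G, g ^ 2 = 1)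
    (h : IsCMTypeWith ρ (T : Set G))
    (hpb : ∀ g : G, ((T.filter fun t => t * g ∈ T).card = 0 ∨ (T.filter fun t => t * g ∈ T).card = T.card) ∨
      2 * (T.filter fun t => t * g ∈ T).card = T.card)
    (h2 : (Finset.univ.filter fun g : G => ∀ t : G, t * g ∈ T ↔ t ∈ T).card = 2) :
    ∀ χ : AddChar (Additive G) ℂ, χ (Additive.ofMul ρ) = -1 →
      ∑ t ∈ T, χ (Additive.ofMul t) = 0 ∨ (∑ t ∈ T, χ (Additive.ofMul t)) ^ 2 = 2 * (T.card : ℂ) := by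
  intro χ hχ
  rcases sum_char_eq_zero_or_sq_eq hexp h hpb χ hχ with h0 | hsq
  · exact Or.inl h0
  · right
    rw [hsq, h2]
    push_cast
    ring

/-- **A near-bent type with `|Stab(T)| = 2` is partially-bent**: `|Stab| = 2` is the equality case of the reflex bound
(tree `two_mul_card_stabilizer_mul_eq_iff_card_eq_two`), and a plateaued type attaining it is partially-bent (tree
`forall_card_filter_of_two_mul_card_stabilizer_mul_eq`). [cite: Carlet2020, §6.2.1 Proposition 94] [cite: Shimura1998, §32.10] -/
theorem partiallyBent_of_nearBent_of_card_stabilizer_eq_two (hexp : ∀ g : G, g ^ 2 = 1)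
    (h : IsCMTypeWith ρ (T : Set G))
    (hnb : ∀ χ : AddChar (Additive G) ℂ, χ (Additive.ofMul ρ) = -1 →
      ∑ t ∈ T, χ (Additive.ofMul t) = 0 ∨ (∑ t ∈ T, χ (Additive.ofMul t)) ^ 2 = 2 * (T.card : ℂ))
    (h2 : (Finset.univ.filter fun g : G => ∀ t : G, t * g ∈ T ↔ t ∈ T).card = 2) :
    ∀ g : G, ((T.filter fun t => t * g ∈ T).card = 0 ∨ (T.filter fun t => t * g ∈ T).card = T.card) ∨
      2 * (T.filter fun t => t * g ∈ T).card = T.card := by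
  have heq := (two_mul_card_stabilizer_mul_eq_iff_card_eq_two hexp h hnb).2 h2
  have hpl : ∀ χ : AddChar (Additive G) ℂ, χ (Additive.ofMul ρ) = -1 →
      ∑ t ∈ T, χ (Additive.ofMul t) = 0 ∨ (∑ t ∈ T, χ (Additive.ofMul t)) ^ 2 = ((2 * T.card : ℕ) : ℂ) := by
    intro χ hχ
    rcases hnb χ hχ with h0 | hsq
    · exact Or.inl h0
    · right; rw [hsq]; push_cast; ring
  exact forall_card_filter_of_two_mul_card_stabilizer_mul_eq hexp h hpl heq

/-- **THE IMPRIMITIVE NEAR-BENT TYPES ARE THE PARTIALLY-BENT TYPES WITH A STABILISER OF ORDER `2`** (as finsets).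
[cite: Carlet2020, §6.2.1 Proposition 94 and Definition 62] [cite: Carlet2020, §6.2.4] [cite: Shimura1998, §32.10] -/
theorem filter_nearBent_card_stabilizer_eq_two_eq (hexp : ∀ g : G, g ^ 2 = 1) (ρ : G) :
    ((Finset.univ : Finset (Finset G)).filter fun T : Finset G => IsCMTypeWith ρ (T : Set G) ∧
        (∀ χ : AddChar (Additive G) ℂ, χ (Additive.ofMul ρ) = -1 →
          ∑ t ∈ T, χ (Additive.ofMul t) = 0 ∨ (∑ t ∈ T, χ (Additive.ofMul t)) ^ 2 = 2 * (T.card : ℂ)) ∧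
        (Finset.univ.filter fun g : G => ∀ t : G, t * g ∈ T ↔ t ∈ T).card = 2) =
      (Finset.univ : Finset (Finset G)).filter fun T : Finset G => IsCMTypeWith ρ (T : Set G) ∧
        (∀ g : G, ((T.filter fun t => t * g ∈ T).card = 0 ∨ (T.filter fun t => t * g ∈ T).card = T.card) ∨
          2 * (T.filter fun t => t * g ∈ T).card = T.card) ∧
        (Finset.univ.filter fun g : G => ∀ t : G, t * g ∈ T ↔ t ∈ T).card = 2 := by
  refine Finset.filter_congr fun T _ => and_congr_right fun h => ?_
  exact ⟨fun ⟨hnb, h2⟩ => ⟨partiallyBent_of_nearBent_of_card_stabilizer_eq_two hexp h hnb h2, h2⟩,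
    fun ⟨hpb, h2⟩ => ⟨nearBent_of_partiallyBent_of_card_stabilizer_eq_two hexp h hpb h2, h2⟩⟩

end Dictionary

/-! ## §2 The partition by the generating involution, and the count per involution -/

section Partition

/-- **THE TYPES WITH `Stab(T) = {1, a}` ARE COUNTED BY THE BENT TYPES OF `G/⟨a⟩`** (`a ≠ 1`): the tree's bijection
`T ↦ T/W` for `W = ⟨a⟩`. [cite: Carlet2020, §6.2.1 Proposition 94 and Definition 62] [cite: Shimura1998, §8.2 Proposition 26] -/
theorem card_filter_stabilizer_eq_pair_eq_card_filter_image (hexp : ∀ g : G, g ^ 2 = 1) (ρ a : G) :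
    ((Finset.univ : Finset (Finset G)).filter fun T : Finset G => IsCMTypeWith ρ (T : Set G) ∧
        (∀ g : G, ((T.filter fun t => t * g ∈ T).card = 0 ∨ (T.filter fun t => t * g ∈ T).card = T.card) ∨
          2 * (T.filter fun t => t * g ∈ T).card = T.card) ∧
        (Finset.univ.filter fun g : G => ∀ t : G, t * g ∈ T ↔ t ∈ T) = {1, a}).card =
      ((Finset.univ : Finset (Finset (G ⧸ Subgroup.zpowers a))).filter fun T' : Finset (G ⧸ Subgroup.zpowers a) =>
        IsCMTypeWith (ρ : G ⧸ Subgroup.zpowers a) (T' : Set (G ⧸ Subgroup.zpowers a)) ∧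
          ∀ ψ : AddChar (Additive (G ⧸ Subgroup.zpowers a)) ℂ, ψ (Additive.ofMul (ρ : G ⧸ Subgroup.zpowers a)) = -1 →
            (∑ q ∈ T', ψ (Additive.ofMul q)) ^ 2 = (T'.card : ℂ)).card := by
  rw [← card_filter_partiallyBent_eq_card_filter_image hexp (Subgroup.zpowers a)]
  congr 1
  exact Finset.filter_congr fun T _ => and_congr_right fun _ => and_congr_right fun _ =>
    stabilizer_eq_pair_iff_nc hexp a

/-- **THE PARTITION BY THE INVOLUTION**: `#{T partially-bent : |Stab(T)| = 2} = Σ_{a ∉ {1, ρ}} #{T partially-bent :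
Stab(T) = {1, a}}` — a stabiliser of order `2` is `{1, a}` for exactly one involution `a`, and `a ≠ ρ`.
[cite: Shimura1998, §8.1 Proposition 25 (proof)] [cite: Carlet2020, §3.1.4 Definition 25] -/
theorem card_filter_partiallyBent_card_stabilizer_eq_two_eq_sum (ρ : G) :
    ((Finset.univ : Finset (Finset G)).filter fun T : Finset G => IsCMTypeWith ρ (T : Set G) ∧
        (∀ g : G, ((T.filter fun t => t * g ∈ T).card = 0 ∨ (T.filter fun t => t * g ∈ T).card = T.card) ∨
          2 * (T.filter fun t => t * g ∈ T).card = T.card) ∧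
        (Finset.univ.filter fun g : G => ∀ t : G, t * g ∈ T ↔ t ∈ T).card = 2).card =
      ∑ a ∈ Finset.univ.filter (fun a : G => a ≠ 1 ∧ a ≠ ρ),
        ((Finset.univ : Finset (Finset G)).filter fun T : Finset G => IsCMTypeWith ρ (T : Set G) ∧
          (∀ g : G, ((T.filter fun t => t * g ∈ T).card = 0 ∨ (T.filter fun t => t * g ∈ T).card = T.card) ∨
            2 * (T.filter fun t => t * g ∈ T).card = T.card) ∧
          (Finset.univ.filter fun g : G => ∀ t : G, t * g ∈ T ↔ t ∈ T) = {1, a}).card := by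
  rw [← Finset.card_biUnion]
  · congr 1
    ext T
    simp only [Finset.mem_biUnion, Finset.mem_filter, Finset.mem_univ, true_and]
    constructor
    · rintro ⟨h, hpb, h2⟩
      obtain ⟨a, ha1, haρ, hS⟩ := exists_stabilizer_eq_pair_nc h h2
      exact ⟨a, ⟨ha1, haρ⟩, h, hpb, hS⟩
    · rintro ⟨a, ⟨ha1, -⟩, h, hpb, hS⟩
      exact ⟨h, hpb, by rw [hS]; exact card_pair_nc ha1⟩
  · intro a ha b hb hab
    simp only [Finset.coe_filter, Finset.mem_univ, true_and, Set.mem_setOf_eq] at ha hb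
    rw [Function.onFun, Finset.disjoint_left]
    intro T hTa hTb
    rw [Finset.mem_filter] at hTa hTb
    have hSa := hTa.2.2.2
    have hSb := hTb.2.2.2
    have hmem : a ∈ ({1, b} : Finset G) := by
      rw [← hSb, hSa]; exact Finset.mem_insert_of_mem (Finset.mem_singleton_self a)
    rw [Finset.mem_insert, Finset.mem_singleton] at hmem
    rcases hmem with h1 | h2
    · exact ha.1 h1
    · exact hab h2

end Partition

/-! ## §3 The censuses: order `16` (`14 · 8 = 112`) and order `64` (`62 · 896 = 55 552`) -/

section Census

/-- **ORDER `16`: `#{T partially-bent : |Stab(T)| = 2} = 14 · 8 = 112`** (`8 = |𝓑₂|` bent types of each order-`8`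
quotient; these `112` are ALL the near-bent types of order `16`, tree `card_stabilizer_eq_two_of_card_eq_sixteen`).
[cite: Tokareva2015BentFunctions, §7.1] [cite: Carlet2020, §6.2.4] -/
theorem card_filter_partiallyBent_card_stabilizer_eq_two_of_card_eq_sixteen (hexp : ∀ g : G, g ^ 2 = 1)
    (hρ1 : ρ ≠ 1) (h16 : Fintype.card G = 16) :
    ((Finset.univ : Finset (Finset G)).filter fun T : Finset G => IsCMTypeWith ρ (T : Set G) ∧
        (∀ g : G, ((T.filter fun t => t * g ∈ T).card = 0 ∨ (T.filter fun t => t * g ∈ T).card = T.card) ∨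
          2 * (T.filter fun t => t * g ∈ T).card = T.card) ∧
        (Finset.univ.filter fun g : G => ∀ t : G, t * g ∈ T ↔ t ∈ T).card = 2).card = 112 := by
  rw [card_filter_partiallyBent_card_stabilizer_eq_two_eq_sum ρ]
  have hterm : ∀ a ∈ Finset.univ.filter (fun a : G => a ≠ 1 ∧ a ≠ ρ),
      ((Finset.univ : Finset (Finset G)).filter fun T : Finset G => IsCMTypeWith ρ (T : Set G) ∧
          (∀ g : G, ((T.filter fun t => t * g ∈ T).card = 0 ∨ (T.filter fun t => t * g ∈ T).card = T.card) ∨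
            2 * (T.filter fun t => t * g ∈ T).card = T.card) ∧
          (Finset.univ.filter fun g : G => ∀ t : G, t * g ∈ T ↔ t ∈ T) = {1, a}).card = 8 := by
    intro a ha
    rw [Finset.mem_filter] at ha
    have ha1 : a ≠ 1 := ha.2.1
    have hρW : ρ ∉ Subgroup.zpowers a := by
      rw [mem_zpowers_iff_nc hexp]; push Not; exact ⟨hρ1, ha.2.2.symm⟩
    rw [← card_filter_partiallyBent_eq_of_card_eq_sixteen hexp hρW h16 (natCard_zpowers_nc hexp ha1)]
    congr 1
    exact Finset.filter_congr fun T _ => and_congr_right fun _ => and_congr_right fun _ =>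
      stabilizer_eq_pair_iff_nc hexp a
  rw [Finset.sum_congr rfl hterm, Finset.sum_const, smul_eq_mul, card_filter_ne_ne_nc hρ1, h16]

/-- **ORDER `16`, NEAR-BENT FORM: the `112` near-bent types of order `16` recovered involution by involution**
(`14` involutions `a ∉ {1, ρ}`, `8` types each; every near-bent type of order `16` has `|Stab| = 2`, tree).
[cite: Tokareva2015BentFunctions, §7.1] [cite: Carlet2020, §6.2.4] -/
theorem card_filter_nearBent_card_stabilizer_eq_two_of_card_eq_sixteen (hexp : ∀ g : G, g ^ 2 = 1)
    (hρ1 : ρ ≠ 1) (h16 : Fintype.card G = 16) :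
    ((Finset.univ : Finset (Finset G)).filter fun T : Finset G => IsCMTypeWith ρ (T : Set G) ∧
        (∀ χ : AddChar (Additive G) ℂ, χ (Additive.ofMul ρ) = -1 →
          ∑ t ∈ T, χ (Additive.ofMul t) = 0 ∨ (∑ t ∈ T, χ (Additive.ofMul t)) ^ 2 = 2 * (T.card : ℂ)) ∧
        (Finset.univ.filter fun g : G => ∀ t : G, t * g ∈ T ↔ t ∈ T).card = 2).card = 112 := by
  rw [filter_nearBent_card_stabilizer_eq_two_eq hexp ρ]
  exact card_filter_partiallyBent_card_stabilizer_eq_two_of_card_eq_sixteen hexp hρ1 h16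

/-- **THE ORDER-`64` CENSUS OF IMPRIMITIVE NEAR-BENT TYPES: EXACTLY `62 · 896 = 55 552` near-bent CM types with a
stabiliser of order `2`** on the elementary abelian group of order `64` (`896 = |𝓑₄|` bent types of each order-`32`
quotient `G/⟨a⟩`, `62` involutions `a ∉ {1, ρ}`). [cite: Tokareva2015BentFunctions, §7.1] [cite: Carlet2020, §6.2.4]
[cite: Carlet2020, §6.2.1 Proposition 94 and Definition 62] -/
theorem card_filter_nearBent_card_stabilizer_eq_two_of_card_eq_sixtyFour (hexp : ∀ g : G, g ^ 2 = 1)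
    (hρ1 : ρ ≠ 1) (h64 : Fintype.card G = 64) :
    ((Finset.univ : Finset (Finset G)).filter fun T : Finset G => IsCMTypeWith ρ (T : Set G) ∧
        (∀ χ : AddChar (Additive G) ℂ, χ (Additive.ofMul ρ) = -1 →
          ∑ t ∈ T, χ (Additive.ofMul t) = 0 ∨ (∑ t ∈ T, χ (Additive.ofMul t)) ^ 2 = 2 * (T.card : ℂ)) ∧
        (Finset.univ.filter fun g : G => ∀ t : G, t * g ∈ T ↔ t ∈ T).card = 2).card = 55552 := by
  rw [filter_nearBent_card_stabilizer_eq_two_eq hexp ρ, card_filter_partiallyBent_card_stabilizer_eq_two_eq_sum ρ]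
  have hterm : ∀ a ∈ Finset.univ.filter (fun a : G => a ≠ 1 ∧ a ≠ ρ),
      ((Finset.univ : Finset (Finset G)).filter fun T : Finset G => IsCMTypeWith ρ (T : Set G) ∧
          (∀ g : G, ((T.filter fun t => t * g ∈ T).card = 0 ∨ (T.filter fun t => t * g ∈ T).card = T.card) ∨
            2 * (T.filter fun t => t * g ∈ T).card = T.card) ∧
          (Finset.univ.filter fun g : G => ∀ t : G, t * g ∈ T ↔ t ∈ T) = {1, a}).card = 896 := by
    intro a ha
    rw [Finset.mem_filter] at ha
    have ha1 : a ≠ 1 := ha.2.1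
    have hρW : ρ ∉ Subgroup.zpowers a := by
      rw [mem_zpowers_iff_nc hexp]; push Not; exact ⟨hρ1, ha.2.2.symm⟩
    rw [← card_filter_partiallyBent_eq_of_card_eq_sixtyFour hexp hρW h64 (natCard_zpowers_nc hexp ha1)]
    congr 1
    exact Finset.filter_congr fun T _ => and_congr_right fun _ => and_congr_right fun _ =>
      stabilizer_eq_pair_iff_nc hexp a
  rw [Finset.sum_congr rfl hterm, Finset.sum_const, smul_eq_mul, card_filter_ne_ne_nc hρ1, h64]

/-- **ORDER `64`: `#{near-bent} = 55 552 + #{near-bent with trivial stabiliser}`** — every near-bent type is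
imprimitive (`|Stab| = 2`) or primitive (`|Stab| = 1`, tree `card_stabilizer_eq_one_or_two`); the primitive ones
(semi-bent functions of `5` variables without linear structure) are not counted here.
[cite: Carlet2020, §6.2.4] [cite: Carlet2020, §3.1.4 Definition 25] [cite: Shimura1998, §32.10] -/
theorem card_filter_nearBent_eq_add_of_card_eq_sixtyFour (hexp : ∀ g : G, g ^ 2 = 1) (hρ1 : ρ ≠ 1)
    (h64 : Fintype.card G = 64) :
    ((Finset.univ : Finset (Finset G)).filter fun T : Finset G => IsCMTypeWith ρ (T : Set G) ∧
        ∀ χ : AddChar (Additive G) ℂ, χ (Additive.ofMul ρ) = -1 →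
          ∑ t ∈ T, χ (Additive.ofMul t) = 0 ∨ (∑ t ∈ T, χ (Additive.ofMul t)) ^ 2 = 2 * (T.card : ℂ)).card =
      55552 + ((Finset.univ : Finset (Finset G)).filter fun T : Finset G => IsCMTypeWith ρ (T : Set G) ∧
        (∀ χ : AddChar (Additive G) ℂ, χ (Additive.ofMul ρ) = -1 →
          ∑ t ∈ T, χ (Additive.ofMul t) = 0 ∨ (∑ t ∈ T, χ (Additive.ofMul t)) ^ 2 = 2 * (T.card : ℂ)) ∧
        (Finset.univ.filter fun g : G => ∀ t : G, t * g ∈ T ↔ t ∈ T).card = 1).card := by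
  rw [← card_filter_nearBent_card_stabilizer_eq_two_of_card_eq_sixtyFour hexp hρ1 h64, ← Finset.card_union_of_disjoint]
  · congr 1
    ext T
    simp only [Finset.mem_union, Finset.mem_filter, Finset.mem_univ, true_and]
    constructor
    · rintro ⟨h, hnb⟩
      rcases card_stabilizer_eq_one_or_two hexp h hnb with h1 | h2
      · exact Or.inr ⟨h, hnb, h1⟩
      · exact Or.inl ⟨h, hnb, h2⟩
    · rintro (⟨h, hnb, -⟩ | ⟨h, hnb, -⟩) <;> exact ⟨h, hnb⟩
  · rw [Finset.disjoint_left]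
    intro T h2 h1
    rw [Finset.mem_filter] at h1 h2
    have := h1.2.2.2
    have := h2.2.2.2
    omega

/-- **ORDER `64`: AT LEAST `55 552` NEAR-BENT CM TYPES** (the imprimitive ones alone). [cite: Tokareva2015BentFunctions, §7.1]
[cite: Carlet2020, §6.2.4] -/
theorem le_card_filter_nearBent_of_card_eq_sixtyFour (hexp : ∀ g : G, g ^ 2 = 1) (hρ1 : ρ ≠ 1)
    (h64 : Fintype.card G = 64) :
    55552 ≤ ((Finset.univ : Finset (Finset G)).filter fun T : Finset G => IsCMTypeWith ρ (T : Set G) ∧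
        ∀ χ : AddChar (Additive G) ℂ, χ (Additive.ofMul ρ) = -1 →
          ∑ t ∈ T, χ (Additive.ofMul t) = 0 ∨ (∑ t ∈ T, χ (Additive.ofMul t)) ^ 2 = 2 * (T.card : ℂ)).card := by
  rw [card_filter_nearBent_eq_add_of_card_eq_sixtyFour hexp hρ1 h64]
  exact Nat.le_add_right _ _

end Census

end NearBentTypesCensus

end ExponentTwo

end CyclicCMType

end Literature.NumberTheory.ComplexMultiplication
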